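import Summits.CriticalPhenomena.PercolationContinuityZ3.Theorems.PercNearOneGluingNoHeavyLowerTailSunflowerMultiPetalKempeMarkedInduce
import HarnessLib
import HarnessLib.Audit

/-!
# `NoHeavyLowerTail` (crux stmt-CriticalPhenomena-4575): VERTEX-DELETION MONOTONICITY OF `T` AT A NEIGHBOUR OF A TERMINAL — `T(K − y) ≤ T(K)` whenever
# `y` is marked or joined to `u` or `v` (kernel-checked; the terminal-adjacent half of the tree's open `TfunVertexMonotone`)

Support file (seat `prim-l12-p2` gen 49; `--supports stmt-CriticalPhenomena-4575`; continuation of `…KempeMarkedLemmaB` (p609343: `TfunM_nonneg`, the step law for every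
outer degree) and `…KempeMarkedInduce` (p610461: `ctypeM_isolate_ofSimple_extCol`)).  No `sorry`; nothing is asserted about the crux.

The step law `T(K−y) + T((K−y)/(S∪u → u)) ≤ T(K)` (p597137, p607581) and `T ≥ 0` (p609343) give at once:
* **`TfunM_isolate_le_of_adj`** — for a non-terminal `y` that is marked or satisfies `mul y u ≠ 0 ∨ mul y v ≠ 0`: `T(K.isolate y) ≤ 3·T(K)`, i.e. `T(K − y) ≤ T(K)`;
* **`Tfun_induce_le_of_adj`** — simple graphs: `Tfun (G − y) u v ≤ Tfun G u v` for every `y ∉ {u,v}` adjacent to `u` or to `v`;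
* `tfunVertexMonotone_of_adj` — the same for every vertex type (the statement of `TfunVertexMonotone`, p421779, restricted to terminal-adjacent `y`).
(VM at a vertex far from both terminals is NOT a consequence of the step law and stays open; its pinned form is false, p421779.)
-/

namespace Summit.CriticalPhenomena.PercolationContinuityZ3.Theorems.SunflowerPartition.Kempe

open Finset

namespace MGraph

variable {V : Type*} [Fintype V] [LinearOrder V] (K : MGraph V)

/-- **VM AT A NEIGHBOUR OF A TERMINAL (marked multigraphs)**: if the non-terminal `y` is marked, or joined to `u` or to `v`, then `T(K.isolate y) ≤ 3·T(K)`. [this work] -/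
theorem TfunM_isolate_le_of_adj (u v y : V) (huv : u ≠ v) (hyu : y ≠ u) (hyv : y ≠ v) (hadj : K.mark y ≠ 0 ∨ K.mul y u ≠ 0 ∨ K.mul y v ≠ 0) :
    (K.isolate y).TfunM u v ≤ 3 * K.TfunM u v := by
  by_cases hmark : K.mark y = 0
  swap
  · let u' : ({y}ᶜ : Set V) := ⟨u, Set.mem_compl_singleton_iff.mpr hyu.symm⟩
    let v' : ({y}ᶜ : Set V) := ⟨v, Set.mem_compl_singleton_iff.mpr hyv.symm⟩
    exact K.TfunM_isolate_le_of_mark y u' v' hmark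
  have key : ∀ u v : V, u ≠ v → y ≠ u → y ≠ v → K.mul y u ≠ 0 → (K.isolate y).TfunM u v ≤ 3 * K.TfunM u v := by
    intro u v huv hyu hyv hadj
    set S := univ.filter (fun w : V => w ≠ u ∧ w ≠ v ∧ w ≠ y ∧ K.mul y w ≠ 0) with hSdef
    have hS : ∀ w, w ∈ S ↔ (w ≠ u ∧ w ≠ v ∧ w ≠ y ∧ K.mul y w ≠ 0) := fun w => by rw [hSdef, mem_filter]; simp
    have hC : 0 ≤ (K.peelContract y S u).TfunM u v := TfunM_nonneg _ u v
    have h0 : 0 ≤ (K.isolate y).TfunM u v := TfunM_nonneg _ u v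
    rcases Nat.lt_or_ge S.card 2 with hlt | hge
    · rcases Nat.lt_or_ge S.card 1 with h0' | h1'
      · have hS0 : S = ∅ := card_eq_zero.1 (by omega)
        have hnone : ∀ w, w ≠ u → w ≠ v → K.mul y w = 0 := by
          intro w hwu hwv
          by_cases hwy : w = y
          · rw [hwy]; exact K.loopless y
          by_contra hne
          have : w ∈ S := (hS w).2 ⟨hwu, hwv, hwy, hne⟩
          rw [hS0] at this
          exact notMem_empty w this
        have hstep := K.TfunM_step_zero u v y huv hyu hyv hmark hadj hnone
        linarith
      · have hone : S.card = 1 := by omega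
        have hstep := K.TfunM_step_one u v y huv hyu hyv hmark hadj S hS hone
        rw [hone] at hstep
        norm_num at hstep
        linarith
    · have hstep := K.TfunM_step u v y huv hyu hyv hmark hadj S hS hge
      rw [pow_succ, mul_assoc] at hstep
      have h3 : (0 : ℤ) < 3 ^ S.card := by positivity
      exact le_of_mul_le_mul_left (by linarith) h3
  rcases hadj with h | h | h
  · exact absurd hmark h
  · exact key u v huv hyu hyv h
  · rw [(K.isolate y).TfunM_comm u v, K.TfunM_comm u v]
    exact key v u huv.symm hyv hyu h

/-- **VM AT A NEIGHBOUR OF A TERMINAL (simple graphs)**: `Tfun (G − y) u v ≤ Tfun G u v` for `y` adjacent to `u` or `v`. [this work] -/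
theorem Tfun_induce_le_of_adj (G : SimpleGraph V) [DecidableRel G.Adj] (y : V) (u v : ({y}ᶜ : Set V)) (huv : u ≠ v) (hadj : G.Adj y u.1 ∨ G.Adj y v.1) :
    Tfun (G.induce ({y}ᶜ : Set V)) u v ≤ Tfun G u.1 v.1 := by
  have hyu : y ≠ u.1 := fun h => Set.mem_compl_singleton_iff.mp u.2 h.symm
  have hyv : y ≠ v.1 := fun h => Set.mem_compl_singleton_iff.mp v.2 h.symm
  have huv' : u.1 ≠ v.1 := fun h => huv (Subtype.ext h)
  have hadj' : (ofSimple G).mark y ≠ 0 ∨ (ofSimple G).mul y u.1 ≠ 0 ∨ (ofSimple G).mul y v.1 ≠ 0 := by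
    unfold ofSimple
    rcases hadj with h | h
    · exact Or.inr (Or.inl (by simp [h]))
    · exact Or.inr (Or.inr (by simp [h]))
  have h1 := (ofSimple G).TfunM_isolate_le_of_adj u.1 v.1 y huv' hyu hyv hadj'
  rw [TfunM_ofSimple] at h1
  have h2 : ((ofSimple G).isolate y).TfunM u.1 v.1 = 3 * Tfun (G.induce ({y}ᶜ : Set V)) u v := by
    rw [((ofSimple G).isolate y).TfunM_eq_sum_extCol y u v, Tfun_eq_sum, mul_sum]
    refine sum_congr (Finset.ext fun τ => by simp only [mem_filter, mem_univ, true_and]) fun τ _ => ?_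
    rw [Fin.sum_univ_three, ctypeM_isolate_ofSimple_extCol G y τ 0, ctypeM_isolate_ofSimple_extCol G y τ 1, ctypeM_isolate_ofSimple_extCol G y τ 2]
    ring
  linarith

end MGraph

open scoped Classical in
/-- **The terminal-adjacent half of `TfunVertexMonotone`, unconditionally**: for every finite graph, every `y`, and terminals `u ≠ v` in `V ∖ {y}` with `y` adjacent to
`u` or to `v`, `Tfun (G − y) u v ≤ Tfun G u v`. [this work] -/
theorem tfunVertexMonotone_of_adj : ∀ (W : Type) [Fintype W] (G : SimpleGraph W) (y : W) (u v : ({y}ᶜ : Set W)), u ≠ v →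
    (G.Adj y u.1 ∨ G.Adj y v.1) → Tfun (G.induce ({y}ᶜ : Set W)) u v ≤ Tfun G u.1 v.1 := by
  intro W _ G y u v huv hadj
  classical
  letI : LinearOrder W := LinearOrder.lift' (Fintype.equivFin W) (Fintype.equivFin W).injective
  convert MGraph.Tfun_induce_le_of_adj G y u v huv hadj using 2

end Summit.CriticalPhenomena.PercolationContinuityZ3.Theorems.SunflowerPartition.Kempe
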